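import Literature.NumberTheory.Rogawski1990.CMThetaDockingClausesTestW1                    -- ROAD W (a) (LH10-plan): `CMThetaDockingClausesTestW1` (the dock on the weight-one automorphic locus); brings ★ T-1 p840296
import Literature.NumberTheory.Rogawski1990.CMLocalAPacketMembers                          -- ★ `KeysCaseTwoLabels`, `Gqs`
import Literature.NumberTheory.GelbartRogawski1991.XiLocalPacketNonsplitThetaPair          -- ★ letter #75-loc `xiLocalPacket_nonsplit_isThetaPair` (a HYPOTHESIS here; ★ p829745 ∕ p839396 prove it)
import HarnessLib

/-!
# Crux `H413`, programme P2 — (D7α) PACKET-LEVEL GLUE ON TEST FUNCTIONS, **WEIGHT-ONE AUTOMORPHIC LOCUS («W1»)**: the members of `⟨πⁿ ∘ e, some πˢ⟩` are CM theta types,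
# docked by `CMThetaDockingClausesTestW1` at a pair `(μ1, χ_f)` WITH `HasWeight μ1 1` AND `IsAutomorphicOneChar χ_f` (ROAD W item (f); F0P2-ref1 (g10) r363∕r364)

Cell `hodgecm-mathlib` (D-0151), FLOOR 0, crux item H413 = `stmt-HodgeConjecture-24833`, route of record `HCCMUnconditional`; programme P2, fallback road PKΠ
`Cruxes/H413/Lines/F0_P2PKPiRung4.lean`.  ROAD W of the LH10 line (LH10-p02 (g0) 2026-09-02T03:19:42Z; F0P2-p06 (g14) census 03:24:26Z; F0P2-ref1 r363 (2)(3), r364).  Seat F0P2-p06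
(g14).  Helper file: THEOREMS ONLY (no definition, no named fact, no instance, no notation, no `sorry`); `--supports stmt-HodgeConjecture-24833 --as helper`; Lines-free.  HONEST
LABEL: HC_CM is proved only modulo the printed citations (2 remaining named inputs hLiu418 24832, h413 24833) until rung 0 closes; this file discharges none of them.

WHAT — the W1 twin of ★ p840385 `F0P2oD7alphaMembersThetaClassTest.d7alpha_packet_members_thetaClassTest` (this seat, g5): the SAME text with `hDock : CMThetaDockingClausesTestW1 …`
(ROAD W (a)) and the two binders `(hw : HasWeight L μ1 1) (haut : IsAutomorphicOneChar (↥(maximalRealSubfield L)) L (IsCMField.complexConj L) χf)` inserted after `hunit`; the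
one elimination site of the dock's `∀` (parent :143) passes `hw haut`.  Its consumer ★ `F0P2vPKPiOfTokens.pkPi_of_tokens` (:212–:220) holds `hw`, `haut` for the DICT-CHOICE
witness `(grdMu ξ, grdChi ξ)` (★ `F0P2iRIGinfDischarge` :180), so the W1 consumer twin feeds them at no cost.
* `d7alpha_packet_members_thetaClassTestW1` — hypotheses BY NAME: `hLoc : xiLocalPacket_nonsplit_isThetaPair` (#75-loc, ★ p839396), `hDock : CMThetaDockingClausesTestW1 …`;
  conclusion unchanged: every member of `⟨πⁿ ∘ e, some πˢ⟩` is `ThetaTypeAtCM … μ1 hμ1 χf ε v c` for some line class `ε`.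

References: [Rogawski1990] §12.2 (2) pp. 173–174; §13.1 Prop. 13.1.3 (d), Prop. 13.1.4 p. 199.  [GelbartRogawski1991] Lem. 5.1.2 p. 466; §1.4 pp. 450–451.
[Liu2021] Def. 4.11, Prop. 4.13.
-/

set_option autoImplicit false
-- the mandated namespace has the single-problem summit's repeated segment (`HodgeConjecture.HodgeConjecture`)
set_option linter.dupNamespace false

noncomputable section

open NumberField IsDedekindDomain MeasureTheory Filter Topology
open scoped Matrix MatrixGroups

open Literature.NumberTheory Literature.NumberTheory.Automorphic Literature.NumberTheory.Automorphic.UnitaryGroup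
open Literature.NumberTheory.Automorphic.IdeleClassGroup
open Literature.NumberTheory.Automorphic.Liu2021 Literature.NumberTheory.Automorphic.Liu2021.Def411WeilCarriers
open Literature.NumberTheory.Rogawski1990 Literature.NumberTheory.GaloisRepresentations
open Literature.NumberTheory.GelbartRogawski1991

namespace Summit.HodgeConjecture.HodgeConjecture.Cruxes.H413.F0P2oD7alphaMembersThetaClassTestW1

section Packet

variable (L : Type) [Field L] [NumberField L] [IsCMField L] (H : Matrix (Fin 3) (Fin 3) L)
  (hH : (H.map (cmConjRingHom L))ᵀ = H) (hHd : IsUnit H.det) (μω : HeckeCharacter L) (hμu : μω.IsUnitary)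
  [∀ v : HeightOneSpectrum (𝓞 ↥(maximalRealSubfield L)), MeasurableSpace ((cmDatum L 3 H).Local v)]
  [∀ v : HeightOneSpectrum (𝓞 ↥(maximalRealSubfield L)),
    MeasurableSpace ((cmDatum L 2 (Matrix.of fun i j : Fin 2 => if i.val + j.val + 1 = 2 then (1 : L) else 0)).Local v ×
      (cmDatum L 1 (Matrix.of fun i j : Fin 1 => if i.val + j.val + 1 = 1 then (1 : L) else 0)).Local v)]
  [∀ (v : HeightOneSpectrum (𝓞 ↥(maximalRealSubfield L)))
      (a : ((cmDatum L 2 (Matrix.of fun i j : Fin 2 => if i.val + j.val + 1 = 2 then (1 : L) else 0)).Local v ×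
        (cmDatum L 1 (Matrix.of fun i j : Fin 1 => if i.val + j.val + 1 = 1 then (1 : L) else 0)).Local v)),
    MeasurableSpace (((cmDatum L 2 (Matrix.of fun i j : Fin 2 => if i.val + j.val + 1 = 2 then (1 : L) else 0)).Local v ×
        (cmDatum L 1 (Matrix.of fun i j : Fin 1 => if i.val + j.val + 1 = 1 then (1 : L) else 0)).Local v) ⧸
      Subgroup.centralizer ({a} : Set ((cmDatum L 2 (Matrix.of fun i j : Fin 2 => if i.val + j.val + 1 = 2 then (1 : L) else 0)).Local v ×
        (cmDatum L 1 (Matrix.of fun i j : Fin 1 => if i.val + j.val + 1 = 1 then (1 : L) else 0)).Local v)))]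
  [∀ (v : HeightOneSpectrum (𝓞 ↥(maximalRealSubfield L))) (γ : (cmDatum L 3 H).Local v),
    MeasurableSpace ((cmDatum L 3 H).Local v ⧸ Subgroup.centralizer ({γ} : Set ((cmDatum L 3 H).Local v)))]
  (Δ : ∀ v : HeightOneSpectrum (𝓞 ↥(maximalRealSubfield L)), LocalTransferFactor L H v)
  (mH : ∀ v : HeightOneSpectrum (𝓞 ↥(maximalRealSubfield L)),
    OrbitalMeasureFamily ((cmDatum L 2 (Matrix.of fun i j : Fin 2 => if i.val + j.val + 1 = 2 then (1 : L) else 0)).Local v ×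
      (cmDatum L 1 (Matrix.of fun i j : Fin 1 => if i.val + j.val + 1 = 1 then (1 : L) else 0)).Local v))
  (mG : ∀ v : HeightOneSpectrum (𝓞 ↥(maximalRealSubfield L)), OrbitalMeasureFamily ((cmDatum L 3 H).Local v))
  (νG : ∀ v : HeightOneSpectrum (𝓞 ↥(maximalRealSubfield L)), Measure ((cmDatum L 3 H).Local v))
  (νH : ∀ v : HeightOneSpectrum (𝓞 ↥(maximalRealSubfield L)),
    Measure ((cmDatum L 2 (Matrix.of fun i j : Fin 2 => if i.val + j.val + 1 = 2 then (1 : L) else 0)).Local v ×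
      (cmDatum L 1 (Matrix.of fun i j : Fin 1 => if i.val + j.val + 1 = 1 then (1 : L) else 0)).Local v))
  (ξloc : OneDimAutRepH L → ∀ v : HeightOneSpectrum (𝓞 ↥(maximalRealSubfield L)),
    (cmDatum L 2 (Matrix.of fun i j : Fin 2 => if i.val + j.val + 1 = 2 then (1 : L) else 0)).Local v ×
      (cmDatum L 1 (Matrix.of fun i j : Fin 1 => if i.val + j.val + 1 = 1 then (1 : L) else 0)).Local v →* ℂˣ)

include hH hHd hμu in
set_option synthInstance.maxHeartbeats 400000 in
set_option maxHeartbeats 16000000 in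
/-- **glueᵀ, PACKET LEVEL: every member of `⟨πⁿ ∘ e, some πˢ⟩` is a CM theta type**, for Keys labels `(π², πⁿ)` (`π²` square-integrable, `πⁿ` not), a supercuspidal
`πˢ ≠ πⁿ ∘ e` completing `πⁿ ∘ e` in (13.1.4) ON TEST FUNCTIONS, from the local theta dichotomy #75-loc (`hLoc`) and the Test theta-docking clause (`hDock`), at a dictionary
pair `(μ1, χ_f)` of `ξ`.  (n) `πⁿ ∘ e` is `hLoc`'s non-`L²` theta-type constituent (Keys: `JH(i_G(χ_ξ)) = {πⁿ, π²}`, `π²` is `L²`, so the non-`L²` constituent IS `πⁿ`); (s) `πˢ` is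
docked by `hDock`.  The Test twin of ★ `F0P2oD7alphaMembersThetaClass.d7alpha_members_thetaClass`, decoupled from the record family's `hCM` parameter.
[cite: Rogawski1990, §12.2 (2) pp. 173–174; §13.1 Prop. 13.1.3 (d), Prop. 13.1.4 p. 199] [cite: GelbartRogawski1991, Lem. 5.1.2 p. 466; §1.4 pp. 450–451] -/
theorem d7alpha_packet_members_thetaClassTestW1
    (hLoc : Literature.NumberTheory.GelbartRogawski1991.xiLocalPacket_nonsplit_isThetaPair)
    {n' : ℕ} (e₁ : Fin 3 × Fin 1 ≃ Fin n') (dV : Fin 3 → L) (hdV : ∀ i, IsCMField.complexConj L (dV i) = dV i) (hdV0 : ∀ i, dV i ≠ 0) (g : GL (Fin 3) L)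
    (hg : ((g : Matrix (Fin 3) (Fin 3) L).map (cmConjRingHom L))ᵀ * H * (g : Matrix (Fin 3) (Fin 3) L) = Matrix.diagonal dV)
    (ξ : OneDimAutRepH L)
    (hDock : CMThetaDockingClausesTestW1 L H Δ mH mG νH νG ξ μω (ξloc ξ) e₁ dV hdV hdV0 g hg)
    (hμω : ∀ x : Literature.NumberTheory.GaloisRepresentations.ideleGroup ↥(maximalRealSubfield L),
        μω (AdeleRing.ideleBaseChange (↥(maximalRealSubfield L)) L x) = quadraticHeckeCharCM L x)
    (μ1 : Literature.NumberTheory.Automorphic.IdeleClassGroup L →ₜ* Circle) (hμ1 : IsConjugateSymplectic L μ1)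
    (χf : UnitaryGroup.finAdelicOne (↥(maximalRealSubfield L)) L (IsCMField.complexConj L) →* ℂˣ)
    (hcont : Continuous χf) (hunit : ∀ z, ‖((χf z : ℂˣ) : ℂ)‖ = 1)
    -- WEIGHT-ONE AUTOMORPHIC LOCUS (W1): the only locus the consumer ★ `pkPi_of_tokens` instantiates (`hw`, `haut` from ★ `rigInf_node_of_xiArchPinned`)
    (hw : HasWeight L μ1 1) (haut : IsAutomorphicOneChar (↥(maximalRealSubfield L)) L (IsCMField.complexConj L) χf)
    -- DICTIONARY (μ): `μ̃1 = η̃⁻¹ · ψ̃⁻¹ · μω`, semi-locally at every finite place of `L⁺` (verbatim from #76)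
    (hdμ : ∀ v : HeightOneSpectrum (𝓞 ↥(maximalRealSubfield L)),
        (toHeckeCharacter L μ1).semilocalComponent L v = (ξ.bcη⁻¹ * ξ.bcψ⁻¹ * μω).semilocalComponent L v)
    -- DICTIONARY (χ_f): `χ_f (z / z̄) = (ψ̃⁻¹ · (η̃⁻¹ ψ̃⁻¹ μω)²) ((1_∞, z))` for every finite idèle `z` of `L` (verbatim from #76)
    (hdχ : ∀ z : (FiniteAdeleRing (𝓞 L) L)ˣ,
        χf (finAdelicCheck (↥(maximalRealSubfield L)) L (IsCMField.complexConj L)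
            (AlgEquiv.ext fun x => by rw [AlgEquiv.mul_apply, IsCMField.complexConj_apply_apply, AlgEquiv.one_apply]) z) =
          (ξ.bcψ⁻¹ * (ξ.bcη⁻¹ * ξ.bcψ⁻¹ * μω) ^ 2)
            (Units.map (N := AdeleRing (𝓞 L) L) (MonoidHom.inr (InfiniteAdeleRing L) (FiniteAdeleRing (𝓞 L) L)) z))
    (v : HeightOneSpectrum (𝓞 ↥(maximalRealSubfield L))) (hns : ∀ w : PlacesOver L v, IsCMField.complexConj L • w.1 = w.1)
    [MeasurableSpace (Gqs L v ⧸ Subgroup.center (Gqs L v))] [BorelSpace (Gqs L v ⧸ Subgroup.center (Gqs L v))]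
    (μZ : Measure (Gqs L v ⧸ Subgroup.center (Gqs L v))) [μZ.IsHaarMeasure]
    -- the form congruence and the Keys labels at `v`
    (T : GL (Fin 3) (LocalRing L v)) (a : LocalRing L v) (ha : IsUnit a)
    (h : formCongr (conjLocal L (IsCMField.complexConj L) v) T (H.map (algebraMap L (LocalRing L v))) =
      a • (Matrix.of fun i j : Fin 3 => if i.val + j.val + 1 = 3 then (1 : L) else 0).map (algebraMap L (LocalRing L v)))
    (π2 πn : IrrClass (Gqs L v))
    (hK : KeysCaseTwoLabels L v (μω.semilocalComponent L v) (torusLocalComponent L (IsCMField.complexConj L) v ξ.η)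
      (torusLocalComponent L (IsCMField.complexConj L) v ξ.ψ) π2 πn)
    (hs2 : π2.IsSquareIntegrable μZ) (hn : ¬ πn.IsSquareIntegrable μZ)
    -- the supercuspidal partner completing `πⁿ ∘ e` in (13.1.4) ON TEST FUNCTIONS
    (πs : IrrClass ((cmDatum L 3 H).Local v)) (hsc : πs.IsSupercuspidal) (hne : πs ≠ IrrClass.comap (cmDatumLocalCongr L v T ha h).symm πn)
    (hId : (⟨IrrClass.comap (cmDatumLocalCongr L v T ha h).symm πn, some πs⟩ : CMLocalAPacket L H v).CharIdentityAtTest L H v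
      (fun c f => c.smoothTrace (νG v) f) (ξloc ξ v) (νH v) (Δ v) (mH v) (mG v))
    (c : IrrClass ((cmDatum L 3 H).Local v))
    (hc : c ∈ (⟨IrrClass.comap (cmDatumLocalCongr L v T ha h).symm πn, some πs⟩ : CMLocalAPacket L H v).members) :
    ∃ ε : (↥(maximalRealSubfield L))ˣ, ThetaTypeAtCM L H e₁ dV hdV hdV0 g hg μ1 hμ1 χf ε v c := by
  rw [LocalAPacket.mem_members_iff] at hc
  rcases hc with hcn | hcs
  · -- (n) the Keys member `πⁿ ∘ e`: it is `hLoc`'s non-L² theta-type constituent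
    obtain ⟨εn, εs, x₀, πs', hconst, hnL2, hθn, -, -, -⟩ :=
      hLoc L H hH hHd e₁ dV hdV hdV0 g hg ξ μω hμu hμω μ1 hμ1 χf hcont hunit hdμ hdχ v hns T a ha h
    have hx₀ : x₀ = πn := by
      rcases (hK.2 x₀).1 hconst with h1 | h2
      · exact h1
      · exact absurd (h2 ▸ hs2) (hnL2 μZ)
    refine ⟨εn, ?_⟩
    rw [hx₀] at hθn
    rw [hcn]
    exact hθn
  · -- (s) the supercuspidal member completing (13.1.4) on test functions: docked by `hDock`
    have hcs' : c = πs := (Option.some_inj.1 hcs).symm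
    subst hcs'
    exact hDock μ1 hμ1 χf hcont hunit hw haut hdμ hdχ v hns T a ha h μZ π2 πn hK hn _ hsc hne hId

end Packet

end Summit.HodgeConjecture.HodgeConjecture.Cruxes.H413.F0P2oD7alphaMembersThetaClassTestW1

end
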